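import Summits.KontsevichZagierPeriods.KontsevichZagierPeriods.Theorems.HermiteRigidityDilogRigidity
import Summits.KontsevichZagierPeriods.KontsevichZagierPeriods.Theorems.HermiteRigidityDilogRigidityCubeTwoSeriesLevel
import Literature.NumberTheory.DiophantineApproximation.DilogLinearIndependenceRational

/-!
# `ReductionRigidity` (stmt-KontsevichZagierPeriods-3407), line `Sketch`, growth programme
# DilogRigidity, wave 2: UNCONDITIONAL WEIGHT-TWO PADÉ BOX ISLANDS AT RATIONAL LEVELS `ν = N/M`

Route `KontsevichZagierPeriods/HermiteRigidity`, crux `ReductionRigidity` (lead c5). The every-weight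
island theorem `padeBoxKernelGen w ν` (Theorems/…PadeBoxIslandsAllWeights.lean) is Conjecture 1 of
Kontsevich–Zagier in kernel form on the sector of all box generators `[□ʲ, ∏ x_l^{a_l}/(ν − ∏ x_l)^m]`,
`j ≤ w`, at a RATIONAL level `ν > 1` (or `ν < 0`), CONDITIONAL on the `ℚ`-rigidity of the `w + 1`
normal-form values `Lᵢ = ∫_□ⁱ dx/(ν − ∏ x)`. For `w = 2` and `ν = N/M` these are `L₀ = M/(N−M)`,
`L₁ = log(N/(N−M)) = Li₁(M/N)`, `L₂ = Li₂(M/N)`, and the Literature theorem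
`one_polylogOne_polylogTwo_linearIndependent_rat` (type-I Hermite–Padé; `N ≥ 10¹⁰ M⁴`) discharges
the hypothesis:

* `stub_dilogRigidityRat` — `1, ∫_□ dx/(N/M − x), ∫_□² dxdy/(N/M − xy)` are `ℚ`-independent for
  `M ≥ 1`, `N ≥ 10¹⁰ M⁴` (the integrals are `polylogSeries s (M/N)` by `integral_cube_one_level` and
  the landed `stub_cubeTwoIntegralSeriesLevel`);
* `stub_padeBoxKernelGenTwoRatUnconditional` — hence `padeBoxKernelGen 2 (N/M)` holds with NO
  hypothesis: unconditional weight-two islands at every rational level `ν = N/M` with `N ≥ 10¹⁰ M⁴`.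

References: M. Kontsevich, D. Zagier, *Periods* (2001), §1.2 [cite: KontsevichZagier2001, §1.2];
S. David, N. Hirata-Kohno, M. Kawashima, Moscow J. Comb. Number Th. 9 (2020), Thm 2.1
[cite: DavidHirataKohnoKawashima2020, Thm 2.1].
-/

noncomputable section

open MeasureTheory Set

namespace Summit.KontsevichZagierPeriods.HermiteRigidity.ReductionRigidity

open Literature.NumberTheory.Transcendental
open Literature.NumberTheory.Transcendental.KZ
open Literature.NumberTheory.DiophantineApproximation

/-- The two box integrals at the rational level `N/M` are the polylogarithmic series
`L_s(M/N)`, `s = 1, 2` (`1 ≤ M`, `2M ≤ N`). [folklore] -/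
theorem integral_cube_eq_polylogSeries_rat {M N : ℕ} (hM : 1 ≤ M) (hMN : 2 * M ≤ N) :
    (∫ p in cube 1, 1 / ((N : ℝ) / (M : ℝ) - p 0)) = DilogPade.polylogSeries 1 ((M : ℝ) / N) ∧
      (∫ p in cube 2, 1 / ((N : ℝ) / (M : ℝ) - p 0 * p 1)) =
        DilogPade.polylogSeries 2 ((M : ℝ) / N) := by
  have hMN' : M < N := by omega
  have hMq : (1 : ℚ) ≤ M := by exact_mod_cast hM
  have hMNq : (M : ℚ) < N := by exact_mod_cast hMN'
  have hν : (1 : ℚ) < (N : ℚ) / M ∨ (N : ℚ) / M < 0 :=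
    Or.inl ((one_lt_div (by linarith)).2 hMNq)
  refine ⟨?_, integral_cube_two_one_div_level_rat hM hMN⟩
  have h := integral_cube_one_level hν
  have hcast : ((((N : ℚ) / M : ℚ)) : ℝ) = (N : ℝ) / (M : ℝ) := by push_cast; ring
  have hcast' : ((((N : ℚ) / M / ((N : ℚ) / M - 1) : ℚ)) : ℝ) = (N : ℝ) / ((N : ℝ) - M) := by
    have hM0 : (M : ℝ) ≠ 0 := by
      have : (1 : ℝ) ≤ M := by exact_mod_cast hM
      linarith
    have hNM : (N : ℝ) - M ≠ 0 := by
      have : (M : ℝ) < N := by exact_mod_cast hMN'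
      linarith
    push_cast
    field_simp
  rw [hcast, hcast'] at h
  rw [h, DilogPade.polylogSeries_one_eq_log_rat hM hMN']

/-- STUB `dilogRigidityRat` (growth programme DilogRigidity wave 2, line `Sketch`, crux
stmt-KontsevichZagierPeriods-3407): at the rational level `N/M` with `M ≥ 1`, `N ≥ 10¹⁰ M⁴`, the
three normal-form values `1`, `∫_□ dx/(N/M − x)`, `∫_□² dxdy/(N/M − xy)` are linearly independent
over `ℚ` (`one_polylogOne_polylogTwo_linearIndependent_rat` after identifying the integrals with the
series `L_s(M/N)`). [cite: DavidHirataKohnoKawashima2020, Thm 2.1] -/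
theorem stub_dilogRigidityRat : ∀ (M N : ℕ), 1 ≤ M → 10 ^ 10 * M ^ 4 ≤ N → ∀ a b c : ℚ,
    (a : ℝ) + b * (∫ p in cube 1, 1 / ((N : ℝ) / (M : ℝ) - p 0)) +
        c * (∫ p in cube 2, 1 / ((N : ℝ) / (M : ℝ) - p 0 * p 1)) = 0 → a = 0 ∧ b = 0 ∧ c = 0 := by
  intro M N hM hN a b c h
  have hM4 : M ≤ M ^ 4 := by
    calc M = M ^ 1 := (pow_one M).symm
      _ ≤ M ^ 4 := Nat.pow_le_pow_right hM (by norm_num)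
  have h2M : 2 * M ≤ N := le_trans (by nlinarith) hN
  obtain ⟨h1, h2⟩ := integral_cube_eq_polylogSeries_rat hM h2M
  rw [h1, h2] at h
  exact one_polylogOne_polylogTwo_linearIndependent_rat M N hM hN a b c h

/-- STUB `padeBoxKernelGenTwoRatUnconditional` (growth programme DilogRigidity wave 2, line `Sketch`,
crux stmt-KontsevichZagierPeriods-3407): **unconditional weight-two islands at rational levels** —
for `M ≥ 1` and `N ≥ 10¹⁰ M⁴`, Conjecture 1 of Kontsevich–Zagier in kernel form on the sector of all
box generators `[□ʲ, ∏ x_l^{a_l}/(N/M − ∏ x_l)^m]` of dimension `j ≤ 2` at the level `ν = N/M`,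
with NO rigidity hypothesis (`padeBoxKernelGen 2 (N/M)` fed with `stub_dilogRigidityRat`; the
constant normal form `L₀ = 1/(ν − 1)` is rational). [cite: KontsevichZagier2001, §1.2] -/
theorem stub_padeBoxKernelGenTwoRatUnconditional : ∀ (M N : ℕ), 1 ≤ M → 10 ^ 10 * M ^ 4 ≤ N →
    ∀ c ∈ AddSubgroup.closure
      {c | ∃ (j : ℕ) (r : IntegralRep j) (a : Fin j → ℕ) (m : ℕ), j ≤ 2 ∧ r.domain = cube j ∧
          EqOn r.integrand
            (fun p => (∏ l, p l ^ a l) / ((((N : ℚ) / (M : ℚ) : ℚ) : ℝ) - ∏ l, p l) ^ m) (cube j) ∧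
          c = KZ.of r},
      KZ.eval c = 0 → c ∈ KZ.relations := by
  intro M N hM hN
  have hM4 : M ≤ M ^ 4 := by
    calc M = M ^ 1 := (pow_one M).symm
      _ ≤ M ^ 4 := Nat.pow_le_pow_right hM (by norm_num)
  have h2M : 2 * M ≤ N := le_trans (by nlinarith) hN
  have hMN' : M < N := by omega
  have hMq : (1 : ℚ) ≤ M := by exact_mod_cast hM
  have hMNq : (M : ℚ) < N := by exact_mod_cast hMN'
  have hν : (1 : ℚ) < (N : ℚ) / M ∨ (N : ℚ) / M < 0 :=
    Or.inl ((one_lt_div (by linarith)).2 hMNq)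
  refine padeBoxKernelGen 2 ((N : ℚ) / M) hν fun β hβ => ?_
  have hcast : ((((N : ℚ) / M : ℚ)) : ℝ) = (N : ℝ) / (M : ℝ) := by push_cast; ring
  have hν1 : (N : ℝ) / (M : ℝ) - 1 ≠ 0 := by
    rw [← hcast]; exact nu_sub_one_ne hν
  have hν1q : (N : ℚ) / M - 1 ≠ 0 := by
    rcases hν with h | h
    · exact sub_ne_zero.2 h.ne'
    · intro h0; linarith [h0]
  -- `Σ_{i<3} βᵢ Lᵢ = β₀/(ν − 1) + β₁ L₁ + β₂ L₂`
  rw [Finset.sum_range_succ, Finset.sum_range_succ, Finset.sum_range_one] at hβ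
  have hL0 : (∫ p in cube 0, 1 / (((((N : ℚ) / M : ℚ)) : ℝ) - ∏ l, p l)) =
      1 / ((N : ℝ) / (M : ℝ) - 1) := by
    have hcube : cube 0 = (univ : Set (Fin 0 → ℝ)) := eq_univ_of_forall fun x i => i.elim0
    rw [hcube, setIntegral_univ, Measure.volume_pi_eq_dirac (default : Fin 0 → ℝ), integral_dirac,
      hcast]
    simp
  have hL1 : (∫ p in cube 1, 1 / (((((N : ℚ) / M : ℚ)) : ℝ) - ∏ l, p l)) =
      ∫ p in cube 1, 1 / ((N : ℝ) / (M : ℝ) - p 0) := by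
    refine setIntegral_congr_fun measurableSet_cube fun p _ => ?_
    simp [hcast]
  have hL2 : (∫ p in cube 2, 1 / (((((N : ℚ) / M : ℚ)) : ℝ) - ∏ l, p l)) =
      ∫ p in cube 2, 1 / ((N : ℝ) / (M : ℝ) - p 0 * p 1) := by
    refine setIntegral_congr_fun measurableSet_cube fun p _ => ?_
    simp [hcast, Fin.prod_univ_two]
  rw [hL0, hL1, hL2] at hβ
  have h := stub_dilogRigidityRat M N hM hN (β 0 / ((N : ℚ) / M - 1)) (β 1) (β 2) (by
    push_cast
    linear_combination hβ)
  obtain ⟨h0, h1, h2⟩ := h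
  have hβ0 : β 0 = 0 := by
    rcases (div_eq_zero_iff).1 h0 with h | h
    · exact h
    · exact absurd h hν1q
  intro i hi
  have hi3 : i < 3 := by simpa using hi
  interval_cases i
  · exact hβ0
  · exact h1
  · exact h2

end Summit.KontsevichZagierPeriods.HermiteRigidity.ReductionRigidity

end
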